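import Summits.Schanuel.Schanuel.Theses.TateNomes
import Literature.NumberTheory.Transcendental.OneMotiveToricProofs

/-!
# Route `TateNomes` — crux `NomeHygiene` PROVED (item stmt-Schanuel-17298)

`theorem nomeHygiene_holds : Summit.Schanuel.Schanuel.Theses.TateNomes.NomeHygiene` — sorry-free,
axioms `propext`, `Classical.choice`, `Quot.sound`.  This file is the line
`Cruxes/NomeHygiene/Lines/integer_shift_rebase.lean` (crux-strategist
planner-cstrat-stmt-Schanuel-17298-b1-0, 2026-08-17) with BOTH registered stubs proved in place:

* `stub_shiftCoincidence` — the KEY LEMMA: for `(1, 2πi, β)` `ℚ`-independent and any `p ∈ ℂ`, only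
  finitely many rational shifts `t` make `(β − t)/2πi` and `p` `GL₂⁺(ℚ)`-related (polynomial form,
  either direction).  Proof: in coordinates `τ_t = x + t·y`, `x = β/2πi`, `y = −1/2πi`
  (transcendental by Lindemann, `Literature.NumberTheory.Transcendental.transcendental_two_pi_I`;
  `1, x, y` independent), the relation is symmetric and transitive as polynomial identities
  (`mob_symm`, `mob_trans`), a relation between two distinct points of the line has `c ≠ 0` and
  makes their product a rational affine form in `x, y` (`pair_affine`), and three such points force
  a rational cubic with non-zero leading coefficient to vanish at `y` (`key_contra`).
* `stub_shiftedTateBasis` — the CONSTRUCTION: slots `β_s = u_s (s < m)`, `2πi + u₀`, `4πi + u₀`,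
  shifts `t_s ∈ ℕ` chosen one at a time outside a finite bad set (`slot_step`, `slot_all`: real
  parts, the ≤ 1 algebraic value, the Key-Lemma coincidences with earlier slots — applicable since
  `(1, 2πi, β_s)` stays independent, `slot_indep` —, and the basis value `t_{m+1} = 2t_m − t_0`);
  then `1 = δ⁻¹ (w_{m+1} − 2w_m + w_0) ∈ span w`, so `span w = span(2πi, 1, u)` and `w` is
  independent by the `finrank` count.
* glue (as in the skeleton): `enlarge` (adjoin `2πi`, `1`, `√2` if missing; `k ≤ 3`; dimension
  count via the independence of `1, 2πi, √2`), `periodBasis_exists` (basis `(2πi, 1, u)` of the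
  span, `exists_linearIndependent_snoc_of_lt_finrank`), `tateBasis_transport`,
  `not_quadratic_of_transcendental`, and the composition `nomeHygiene_holds`.

Mathematical source: the proof plan of grounder g77-1 (item note 2026-08-17T02:27Z) — integer
shifts along the transcendental cusp direction and the "at most two `t`" lemma —, made
unconditional in the choice of direction (`y = −1/2πi` for every slot, answering the refuter's
cubic-field warning) and formalised here. [cite: NesterenkoPhilippon2001, Ch. 3 §1 (Tate-position
hypotheses of Conjecture 1.11); Lindemann 1882 via tree `transcendental_two_pi_I`]
-/

noncomputable section

-- `Summit.Schanuel.Schanuel.…` is the mandated summit/sub-problem namespace (single-conjunct summit), hence: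
set_option linter.dupNamespace false

namespace Summit.Schanuel.Schanuel.Theorems.TateNomesNomeHygiene

open Complex

/-! # Part I — the Key Lemma `stub_shiftCoincidence` -/



/-! ## The Möbius relation as polynomial identities -/

/-- Symmetry of the `GL₂⁺(ℚ)`-relation in polynomial form (adjugate matrix). -/
theorem mob_symm {α β : ℂ} {a b c d : ℚ} (hdet : 0 < a * d - b * c)
    (h : β * ((c : ℂ) * α + d) = (a : ℂ) * α + b) :
    ∃ a' b' c' d' : ℚ, 0 < a' * d' - b' * c' ∧ α * ((c' : ℂ) * β + d') = (a' : ℂ) * β + b' := by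
  refine ⟨d, -b, -c, a, ?_, ?_⟩
  · have e : d * a - -b * -c = a * d - b * c := by ring
    rw [e]
    exact hdet
  · push_cast
    linear_combination (-1 : ℂ) * h

/-- Transitivity of the `GL₂⁺(ℚ)`-relation in polynomial form (matrix product; the identity is
obtained by multiplying the second relation by `cα + d`, so no non-vanishing is needed). -/
theorem mob_trans {α β γ : ℂ} {a b c d a' b' c' d' : ℚ} (hdet : 0 < a * d - b * c)
    (hdet' : 0 < a' * d' - b' * c')
    (h1 : β * ((c : ℂ) * α + d) = (a : ℂ) * α + b)
    (h2 : γ * ((c' : ℂ) * β + d') = (a' : ℂ) * β + b') :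
    ∃ A B C D : ℚ, 0 < A * D - B * C ∧ γ * ((C : ℂ) * α + D) = (A : ℂ) * α + B := by
  refine ⟨a' * a + b' * c, a' * b + b' * d, c' * a + d' * c, c' * b + d' * d, ?_, ?_⟩
  · have e : (a' * a + b' * c) * (c' * b + d' * d) - (a' * b + b' * d) * (c' * a + d' * c) =
        (a' * d' - b' * c') * (a * d - b * c) := by ring
    rw [e]
    exact mul_pos hdet' hdet
  · push_cast
    linear_combination ((c : ℂ) * α + d) * h2 - (γ * c' - a') * h1

/-! ## The three-point rigidity -/

/-- A relation between two distinct points `x + t y`, `x + t' y` of the line has `c ≠ 0` and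
therefore expresses the product `(x + t y)(x + t' y)` as a rational affine form in `x, y`. -/
theorem pair_affine {x y : ℂ}
    (hL : ∀ q₀ q₁ q₂ : ℚ, (q₀ : ℂ) + q₁ * x + q₂ * y = 0 → q₀ = 0 ∧ q₁ = 0 ∧ q₂ = 0)
    {t t' : ℚ} (htt : t ≠ t')
    (h : ∃ a b c d : ℚ, 0 < a * d - b * c ∧
      (x + (t' : ℂ) * y) * ((c : ℂ) * (x + (t : ℂ) * y) + d) = (a : ℂ) * (x + (t : ℂ) * y) + b) :
    ∃ r₀ r₁ r₂ : ℚ, (x + (t : ℂ) * y) * (x + (t' : ℂ) * y) = (r₀ : ℂ) + r₁ * x + r₂ * y := by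
  obtain ⟨a, b, c, d, hdet, h⟩ := h
  by_cases hc : c = 0
  · subst hc
    exfalso
    obtain ⟨hb, hda, hdt⟩ := hL (-b) (d - a) (d * t' - a * t) (by push_cast; linear_combination h)
    have hd : d = a := by linarith
    rw [hd] at hdet hdt
    have ha : a ≠ 0 := by
      rintro rfl
      simp at hdet
    have hmul : a * (t' - t) = 0 := by linear_combination hdt
    rcases mul_eq_zero.1 hmul with h1 | h1
    · exact ha h1
    · exact htt (by linarith)
  · refine ⟨b / c, (a - d) / c, (a * t - d * t') / c, ?_⟩
    have hc' : (c : ℂ) ≠ 0 := by exact_mod_cast hc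
    have key : (x + (t : ℂ) * y) * (x + (t' : ℂ) * y) * c =
        (b : ℂ) + (a - d) * x + (a * t - d * t') * y := by
      linear_combination h
    push_cast
    field_simp
    linear_combination key

/-- Three pairwise-related distinct points `x + tᵢ y` on a line with `1, x, y` `ℚ`-independent force
`y` to be algebraic (a rational cubic with non-zero leading coefficient vanishes at `y`). -/
theorem key_contra {x y : ℂ}
    (hL : ∀ q₀ q₁ q₂ : ℚ, (q₀ : ℂ) + q₁ * x + q₂ * y = 0 → q₀ = 0 ∧ q₁ = 0 ∧ q₂ = 0)
    (hy : Transcendental ℚ y) {t₁ t₂ t₃ : ℚ} (h12 : t₁ ≠ t₂) (h13 : t₁ ≠ t₃) (h23 : t₂ ≠ t₃)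
    (r12 : ∃ a b c d : ℚ, 0 < a * d - b * c ∧
      (x + (t₂ : ℂ) * y) * ((c : ℂ) * (x + (t₁ : ℂ) * y) + d) = (a : ℂ) * (x + (t₁ : ℂ) * y) + b)
    (r13 : ∃ a b c d : ℚ, 0 < a * d - b * c ∧
      (x + (t₃ : ℂ) * y) * ((c : ℂ) * (x + (t₁ : ℂ) * y) + d) = (a : ℂ) * (x + (t₁ : ℂ) * y) + b)
    (r23 : ∃ a b c d : ℚ, 0 < a * d - b * c ∧
      (x + (t₃ : ℂ) * y) * ((c : ℂ) * (x + (t₂ : ℂ) * y) + d) = (a : ℂ) * (x + (t₂ : ℂ) * y) + b) :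
    False := by
  obtain ⟨α₀, α₁, α₂, hA⟩ := pair_affine hL h12 r12
  obtain ⟨β₀, β₁, β₂, hB⟩ := pair_affine hL h13 r13
  obtain ⟨γ₀, γ₁, γ₂, hC⟩ := pair_affine hL h23 r23
  -- `D y² = n₀ + n₁ x + n₂ y` with `D = (t₁ - t₂)(t₂ - t₃)(t₁ - t₃) ≠ 0`
  set D : ℚ := (t₁ - t₂) * (t₂ - t₃) * (t₁ - t₃) with hD
  set n₀ : ℚ := (t₁ - t₃) * (α₀ - β₀) - (t₂ - t₃) * (α₀ - γ₀) with hn₀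
  set n₁ : ℚ := (t₁ - t₃) * (α₁ - β₁) - (t₂ - t₃) * (α₁ - γ₁) with hn₁
  set n₂ : ℚ := (t₁ - t₃) * (α₂ - β₂) - (t₂ - t₃) * (α₂ - γ₂) with hn₂
  have hD0 : D ≠ 0 := by
    rw [hD]
    exact mul_ne_zero (mul_ne_zero (sub_ne_zero.2 h12) (sub_ne_zero.2 h23)) (sub_ne_zero.2 h13)
  have H1 : (D : ℂ) * y ^ 2 = (n₀ : ℂ) + n₁ * x + n₂ * y := by
    rw [hD, hn₀, hn₁, hn₂]
    push_cast
    linear_combination ((t₁ : ℂ) - t₃) * hA - ((t₁ : ℂ) - t₃) * hB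
      - ((t₂ : ℂ) - t₃) * hA + ((t₂ : ℂ) - t₃) * hC
  -- `D' (x y) = m₀ + m₁ x + m₂ y` with `D' = (t₂ - t₃) D ≠ 0`:
  -- from `(t₂ - t₃)(x y + t₁ y²) = A - B` and `D y² = N`.
  set D' : ℚ := (t₂ - t₃) * D with hD'
  set m₀ : ℚ := D * (α₀ - β₀) - t₁ * (t₂ - t₃) * n₀ with hm₀
  set m₁ : ℚ := D * (α₁ - β₁) - t₁ * (t₂ - t₃) * n₁ with hm₁
  set m₂ : ℚ := D * (α₂ - β₂) - t₁ * (t₂ - t₃) * n₂ with hm₂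
  have hD'0 : D' ≠ 0 := by
    rw [hD']
    exact mul_ne_zero (sub_ne_zero.2 h23) hD0
  have H2 : (D' : ℂ) * (x * y) = (m₀ : ℂ) + m₁ * x + m₂ * y := by
    rw [hD', hm₀, hm₁, hm₂]
    push_cast
    linear_combination (D : ℂ) * hA - (D : ℂ) * hB - (t₁ : ℂ) * ((t₂ : ℂ) - t₃) * H1
  -- eliminate `x`: a rational cubic with leading coefficient `D' D ≠ 0` vanishes at `y`
  apply hy
  refine ⟨Polynomial.C (D' * D) * Polynomial.X ^ 3 + Polynomial.C (-(D' * n₂ + m₁ * D)) *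
      Polynomial.X ^ 2 + Polynomial.C (-(D' * n₀ + m₂ * n₁ - m₁ * n₂)) * Polynomial.X +
      Polynomial.C (-(m₀ * n₁ - m₁ * n₀)), ?_, ?_⟩
  · intro hp
    have h3 := congrArg (fun q => Polynomial.coeff q 3) hp
    simp only [Polynomial.coeff_add, Polynomial.coeff_C_mul, Polynomial.coeff_X_pow,
      Polynomial.coeff_C, Polynomial.coeff_X, Polynomial.coeff_zero] at h3
    norm_num at h3
    rcases h3 with h3 | h3
    · exact hD'0 h3
    · exact hD0 h3
  · simp only [map_add, map_mul, map_pow, map_neg, Polynomial.aeval_X, Polynomial.aeval_C,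
      eq_ratCast]
    push_cast
    linear_combination ((D' : ℂ) * y - m₁) * H1 + (n₁ : ℂ) * H2

/-! ## The registered stub -/

/-- **`stub_shiftCoincidence`** (Key Lemma of line `integer_shift_rebase`, registered on
stmt-Schanuel-17298; name and signature verbatim). -/
theorem stub_shiftCoincidence :
    ∀ (β p : ℂ), LinearIndependent ℚ ![(1 : ℂ), 2 * (Real.pi : ℂ) * Complex.I, β] →
      Set.Finite {t : ℚ | ∃ a b c d : ℚ, 0 < a * d - b * c ∧
        ((β - (t : ℂ)) / (2 * (Real.pi : ℂ) * Complex.I) * ((c : ℂ) * p + (d : ℂ)) =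
            (a : ℂ) * p + (b : ℂ) ∨
         p * ((c : ℂ) * ((β - (t : ℂ)) / (2 * (Real.pi : ℂ) * Complex.I)) + (d : ℂ)) =
            (a : ℂ) * ((β - (t : ℂ)) / (2 * (Real.pi : ℂ) * Complex.I)) + (b : ℂ))} := by
  intro β p hβ
  set T : ℂ := 2 * (Real.pi : ℂ) * Complex.I with hT
  have hT0 : T ≠ 0 := by
    rw [hT]
    exact Complex.two_pi_I_ne_zero
  -- nome coordinates on the line: `τ_t = x + t y`
  set x : ℂ := β / T with hx
  set y : ℂ := -1 / T with hy
  have hτ : ∀ t : ℚ, (β - (t : ℂ)) / T = x + (t : ℂ) * y := by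
    intro t
    rw [hx, hy]
    field_simp
    ring
  -- `1, x, y` are `ℚ`-independent (multiply a relation by `T = 2πi`)
  have hL : ∀ q₀ q₁ q₂ : ℚ, (q₀ : ℂ) + q₁ * x + q₂ * y = 0 → q₀ = 0 ∧ q₁ = 0 ∧ q₂ = 0 := by
    intro q₀ q₁ q₂ h
    have h' : ((-q₂ : ℚ) : ℂ) * 1 + (q₀ : ℂ) * T + (q₁ : ℂ) * β = 0 := by
      have hm := congrArg (fun z => z * T) h
      simp only [zero_mul] at hm
      rw [hx, hy] at hm
      field_simp at hm
      push_cast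
      linear_combination hm
    have h0 := (Fintype.linearIndependent_iff.1 hβ) ![-q₂, q₀, q₁] (by
      rw [Fin.sum_univ_three]
      simp only [Matrix.cons_val_zero, Matrix.cons_val_one, Matrix.head_cons,
        Matrix.cons_val_two, Matrix.tail_cons, Rat.smul_def]
      exact h')
    have e0 := h0 0
    have e1 := h0 1
    have e2 := h0 2
    simp only [Matrix.cons_val_zero, Matrix.cons_val_one, Matrix.head_cons,
      Matrix.cons_val_two, Matrix.tail_cons, neg_eq_zero] at e0 e1 e2
    exact ⟨e1, e2, e0⟩
  -- `y = -1/2πi` is transcendental (Lindemann)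
  have hyT : Transcendental ℚ y := by
    intro halg
    apply Literature.NumberTheory.Transcendental.transcendental_two_pi_I
    have e : (2 * Real.pi * I : ℂ) = -y⁻¹ := by
      rw [hy]
      field_simp
      rw [hT]
    rw [e]
    exact halg.inv.neg
  -- normalise every bad shift to a relation "`p` from `τ_t`"
  set S : Set ℚ := {t : ℚ | ∃ a b c d : ℚ, 0 < a * d - b * c ∧
        ((β - (t : ℂ)) / T * ((c : ℂ) * p + (d : ℂ)) = (a : ℂ) * p + (b : ℂ) ∨
         p * ((c : ℂ) * ((β - (t : ℂ)) / T) + (d : ℂ)) =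
            (a : ℂ) * ((β - (t : ℂ)) / T) + (b : ℂ))} with hS
  have hN : ∀ t : ℚ, t ∈ S → ∃ a b c d : ℚ, 0 < a * d - b * c ∧
      p * ((c : ℂ) * (x + (t : ℂ) * y) + d) = (a : ℂ) * (x + (t : ℂ) * y) + b := by
    intro t ht
    rw [hS, Set.mem_setOf_eq] at ht
    obtain ⟨a, b, c, d, hdet, h | h⟩ := ht
    · rw [hτ t] at h
      exact mob_symm hdet h
    · rw [hτ t] at h
      exact ⟨a, b, c, d, hdet, h⟩
  have hP : ∀ t t' : ℚ, t ∈ S → t' ∈ S → ∃ a b c d : ℚ, 0 < a * d - b * c ∧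
      (x + (t' : ℂ) * y) * ((c : ℂ) * (x + (t : ℂ) * y) + d) = (a : ℂ) * (x + (t : ℂ) * y) + b := by
    intro t t' ht ht'
    obtain ⟨a, b, c, d, hdet, h⟩ := hN t ht
    obtain ⟨a', b', c', d', hdet', h'⟩ := hN t' ht'
    obtain ⟨a'', b'', c'', d'', hdet'', h''⟩ := mob_symm hdet' h'
    exact mob_trans hdet hdet'' h h''
  -- three distinct bad shifts would contradict `key_contra`
  by_contra hinf
  have hSi : S.Infinite := hinf
  obtain ⟨t₁, ht₁, -⟩ := hSi.exists_notMem_finset ∅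
  obtain ⟨t₂, ht₂, ht₂n⟩ := hSi.exists_notMem_finset {t₁}
  obtain ⟨t₃, ht₃, ht₃n⟩ := hSi.exists_notMem_finset {t₁, t₂}
  simp only [Finset.mem_singleton, Finset.mem_insert, not_or] at ht₂n ht₃n
  exact key_contra hL hyT (Ne.symm ht₂n) (Ne.symm ht₃n.1) (Ne.symm ht₃n.2)
    (hP t₁ t₂ ht₁ ht₂) (hP t₁ t₃ ht₁ ht₃) (hP t₂ t₃ ht₂ ht₃)


/-! # Part II — the shifted Tate basis `stub_shiftedTateBasis` -/



/-! ## Coefficients against the basis `(T, 1, u)` -/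

/-- Reading off coefficients of `T`, `1`, `u j` from the independence of `(T, 1, u)`. -/
theorem basis_coeff {T : ℂ} {m : ℕ} {u : Fin m → ℂ}
    (hu : LinearIndependent ℚ (Fin.cons T (Fin.cons (1 : ℂ) u) : Fin (m + 2) → ℂ))
    (a b q : ℚ) (j : Fin m) (h : (a : ℂ) * T + b + q * u j = 0) : a = 0 ∧ b = 0 ∧ q = 0 := by
  classical
  have hsum : ∑ i, (Fin.cons a (Fin.cons b (Pi.single j q)) : Fin (m + 2) → ℚ) i •
      (Fin.cons T (Fin.cons (1 : ℂ) u) : Fin (m + 2) → ℂ) i = 0 := by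
    rw [Fin.sum_univ_succ, Fin.sum_univ_succ]
    simp only [Fin.cons_zero, Fin.cons_succ]
    rw [Finset.sum_eq_single j]
    · simp only [Pi.single_eq_same, Rat.smul_def, mul_one]
      linear_combination h
    · intro i _ hij
      simp [hij]
    · intro hj
      exact absurd (Finset.mem_univ j) hj
  have h0 := Fintype.linearIndependent_iff.1 hu _ hsum
  have ea := h0 0
  have eb := h0 (Fin.succ 0)
  have eq := h0 (j.succ.succ)
  simp only [Fin.cons_zero, Fin.cons_succ, Pi.single_eq_same] at ea eb eq
  exact ⟨ea, eb, eq⟩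

/-- Every slot base point `β = k·T + u j` keeps `(1, T, β)` independent. -/
theorem slot_indep {T : ℂ} {m : ℕ} {u : Fin m → ℂ}
    (hu : LinearIndependent ℚ (Fin.cons T (Fin.cons (1 : ℂ) u) : Fin (m + 2) → ℂ))
    (β : ℂ) (k : ℚ) (j : Fin m) (hβ : β = (k : ℂ) * T + u j) :
    LinearIndependent ℚ ![(1 : ℂ), T, β] := by
  subst hβ
  rw [Fintype.linearIndependent_iff]
  intro g hg
  rw [Fin.sum_univ_three] at hg
  simp only [Matrix.cons_val_zero, Matrix.cons_val_one, Matrix.head_cons, Matrix.cons_val_two,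
    Matrix.tail_cons, Rat.smul_def] at hg
  obtain ⟨h1, h0, h2⟩ :=
    basis_coeff hu (g 1 + k * g 2) (g 0) (g 2) j (by push_cast; linear_combination hg)
  have g1 : g 1 = 0 := by
    rw [h2, mul_zero, add_zero] at h1
    exact h1
  intro i
  fin_cases i
  · exact h0
  · exact g1
  · exact h2

/-! ## The sequential choice of the integer shifts -/

/-! The slot invariant after the first `s` shifts `t 0, …, t (s-1)` have been chosen is the
conjunction of: real parts beaten (`Re β_i < t_i`), transcendental nomes, no `GL₂⁺(ℚ)`-relation
with an earlier slot (both orders), and — once all `m + 2` slots are set — the basis condition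
`t_{m+1} ≠ 2 t_m − t_0`.  It is written out verbatim in `slot_step` / `slot_all` (no auxiliary
`def`, so that the file carries no Prop-valued definitions). -/

/-- One more slot: the bad shifts form a finite set, so a good natural number exists. -/
theorem slot_step {T : ℂ} (hT : Transcendental ℚ T) (hT0 : T ≠ 0) {β : ℕ → ℂ} {m : ℕ}
    (hK : ∀ (s : ℕ) (p : ℂ), Set.Finite {q : ℚ | ∃ a b c d : ℚ, 0 < a * d - b * c ∧
        ((β s - (q : ℂ)) / T * ((c : ℂ) * p + (d : ℂ)) = (a : ℂ) * p + (b : ℂ) ∨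
         p * ((c : ℂ) * ((β s - (q : ℂ)) / T) + (d : ℂ)) =
           (a : ℂ) * ((β s - (q : ℂ)) / T) + (b : ℂ))})
    (t : ℕ → ℕ) (s : ℕ)
    (h : ((∀ i < s, (β i).re < t i) ∧
      (∀ i < s, Transcendental ℚ ((β i - t i) / T)) ∧
      (∀ i < s, ∀ i' < i, ¬ ∃ a b c d : ℚ, 0 < a * d - b * c ∧
        ((β i - t i) / T * ((c : ℂ) * ((β i' - t i') / T) + d) = (a : ℂ) * ((β i' - t i') / T) + b ∨
         (β i' - t i') / T * ((c : ℂ) * ((β i - t i) / T) + d) = (a : ℂ) * ((β i - t i) / T) + b)) ∧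
      (m + 2 ≤ s → (t (m + 1) : ℚ) ≠ 2 * t m - t 0))) :
    ∃ t' : ℕ → ℕ, (∀ i < s, t' i = t i) ∧
      ((∀ i < (s + 1), (β i).re < t' i) ∧
      (∀ i < (s + 1), Transcendental ℚ ((β i - t' i) / T)) ∧
      (∀ i < (s + 1), ∀ i' < i, ¬ ∃ a b c d : ℚ, 0 < a * d - b * c ∧
        ((β i - t' i) / T * ((c : ℂ) * ((β i' - t' i') / T) + d) = (a : ℂ) * ((β i' - t' i') / T) + b ∨
         (β i' - t' i') / T * ((c : ℂ) * ((β i - t' i) / T) + d) = (a : ℂ) * ((β i - t' i) / T) + b)) ∧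
      (m + 2 ≤ (s + 1) → (t' (m + 1) : ℚ) ≠ 2 * t' m - t' 0)) := by
  classical
  obtain ⟨hre, htr, hrel, hdet⟩ := h
  -- the four finite bad sets
  have hB₁ : Set.Finite {n : ℕ | (n : ℝ) ≤ (β s).re} := by
    refine (Set.finite_Iic ⌈(β s).re⌉₊).subset ?_
    intro n hn
    rw [Set.mem_setOf_eq] at hn
    exact Nat.cast_le.1 (hn.trans (Nat.le_ceil _))
  have hB₂ : Set.Finite {n : ℕ | IsAlgebraic ℚ ((β s - n) / T)} := by
    refine Set.Subsingleton.finite ?_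
    intro n hn n' hn'
    rw [Set.mem_setOf_eq] at hn hn'
    by_contra hne
    have hne' : ((n' : ℂ) - n) ≠ 0 := by
      rw [sub_ne_zero]
      exact_mod_cast (Ne.symm hne)
    have hdiff : IsAlgebraic ℚ (((n' : ℂ) - n) / T) := by
      have := hn.sub hn'
      have e : (β s - n) / T - (β s - n') / T = ((n' : ℂ) - n) / T := by
        field_simp
        ring
      rw [e] at this
      exact this
    have hrat : IsAlgebraic ℚ ((n' : ℂ) - n) := (isAlgebraic_nat n').sub (isAlgebraic_nat n)
    apply hT
    have e : T = ((n' : ℂ) - n) * ((((n' : ℂ) - n) / T))⁻¹ := by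
      field_simp
    rw [e]
    exact hrat.mul hdiff.inv
  have hB₃ : Set.Finite (⋃ i ∈ Finset.range s, ((Nat.cast : ℕ → ℚ) ⁻¹'
      {q : ℚ | ∃ a b c d : ℚ, 0 < a * d - b * c ∧
        ((β s - (q : ℂ)) / T * ((c : ℂ) * ((β i - t i) / T) + (d : ℂ)) =
            (a : ℂ) * ((β i - t i) / T) + (b : ℂ) ∨
         (β i - t i) / T * ((c : ℂ) * ((β s - (q : ℂ)) / T) + (d : ℂ)) =
            (a : ℂ) * ((β s - (q : ℂ)) / T) + (b : ℂ))})) := by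
    refine Set.Finite.biUnion (Finset.range s).finite_toSet (fun i _ => ?_)
    exact (hK s ((β i - t i) / T)).preimage Nat.cast_injective.injOn
  have hB₄ : Set.Finite {n : ℕ | (n : ℚ) = 2 * t m - t 0} :=
    Set.Subsingleton.finite (fun n hn n' hn' => Nat.cast_injective (R := ℚ) (hn.trans hn'.symm))
  obtain ⟨n, hn⟩ := (((hB₁.union hB₂).union (hB₃.union hB₄)).infinite_compl).nonempty
  simp only [Set.mem_compl_iff, Set.mem_union, Set.mem_setOf_eq, not_or, Set.mem_iUnion,
    Set.mem_preimage, not_exists, Finset.mem_range] at hn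
  obtain ⟨⟨hn1, hn2⟩, hn3, hn4⟩ := hn
  -- the new assignment
  refine ⟨Function.update t s n, fun i hi => Function.update_of_ne (ne_of_lt hi) _ _, ?_, ?_, ?_, ?_⟩
  · intro i hi
    rcases (Nat.lt_succ_iff.1 hi).lt_or_eq with hi | rfl
    · rw [Function.update_of_ne (ne_of_lt hi)]
      exact hre i hi
    · rw [Function.update_self]
      exact not_le.1 hn1
  · intro i hi
    rcases (Nat.lt_succ_iff.1 hi).lt_or_eq with hi | rfl
    · rw [Function.update_of_ne (ne_of_lt hi)]
      exact htr i hi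
    · rw [Function.update_self]
      exact hn2
  · intro i hi i' hi'
    rcases (Nat.lt_succ_iff.1 hi).lt_or_eq with hi | rfl
    · rw [Function.update_of_ne (ne_of_lt hi), Function.update_of_ne (ne_of_lt (hi'.trans hi))]
      exact hrel i hi i' hi'
    · rw [Function.update_self, Function.update_of_ne (ne_of_lt hi')]
      have := hn3 i' hi'
      simpa only [Rat.cast_natCast, not_exists] using this
  · intro hs
    by_cases hs' : m + 2 ≤ s
    · rw [Function.update_of_ne (by omega : m + 1 ≠ s), Function.update_of_ne (by omega : m ≠ s),
        Function.update_of_ne (by omega : 0 ≠ s)]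
      exact hdet hs'
    · obtain rfl : s = m + 1 := by omega
      rw [Function.update_self, Function.update_of_ne (by omega : m ≠ m + 1),
        Function.update_of_ne (by omega : 0 ≠ m + 1)]
      exact hn4

/-- All slots: by induction from the empty assignment. -/
theorem slot_all {T : ℂ} (hT : Transcendental ℚ T) (hT0 : T ≠ 0) {β : ℕ → ℂ} {m : ℕ}
    (hK : ∀ (s : ℕ) (p : ℂ), Set.Finite {q : ℚ | ∃ a b c d : ℚ, 0 < a * d - b * c ∧
        ((β s - (q : ℂ)) / T * ((c : ℂ) * p + (d : ℂ)) = (a : ℂ) * p + (b : ℂ) ∨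
         p * ((c : ℂ) * ((β s - (q : ℂ)) / T) + (d : ℂ)) =
           (a : ℂ) * ((β s - (q : ℂ)) / T) + (b : ℂ))}) :
    ∀ s : ℕ, ∃ t : ℕ → ℕ,
      ((∀ i < s, (β i).re < t i) ∧
      (∀ i < s, Transcendental ℚ ((β i - t i) / T)) ∧
      (∀ i < s, ∀ i' < i, ¬ ∃ a b c d : ℚ, 0 < a * d - b * c ∧
        ((β i - t i) / T * ((c : ℂ) * ((β i' - t i') / T) + d) = (a : ℂ) * ((β i' - t i') / T) + b ∨
         (β i' - t i') / T * ((c : ℂ) * ((β i - t i) / T) + d) = (a : ℂ) * ((β i - t i) / T) + b)) ∧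
      (m + 2 ≤ s → (t (m + 1) : ℚ) ≠ 2 * t m - t 0)) := by
  intro s
  induction s with
  | zero =>
    refine ⟨fun _ => 0, ?_, ?_, ?_, ?_⟩
    · intro i hi; omega
    · intro i hi; omega
    · intro i hi; omega
    · intro h; omega
  | succ s ih =>
    obtain ⟨t, ht⟩ := ih
    obtain ⟨t', -, ht'⟩ := slot_step hT hT0 hK t s ht
    exact ⟨t', ht'⟩

/-! ## The registered stub -/

/-- **`stub_shiftedTateBasis`** (construction stub of line `integer_shift_rebase`, registered on
stmt-Schanuel-17298; name and signature verbatim): the Key Lemma implies that the span of a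
`ℚ`-independent `(2πi, 1, u₁, …, u_m)`, `m ≥ 1`, has a Tate-position basis with transcendental
nomes. -/
theorem stub_shiftedTateBasis :
    (∀ (β p : ℂ), LinearIndependent ℚ ![(1 : ℂ), 2 * (Real.pi : ℂ) * Complex.I, β] →
      Set.Finite {t : ℚ | ∃ a b c d : ℚ, 0 < a * d - b * c ∧
        ((β - (t : ℂ)) / (2 * (Real.pi : ℂ) * Complex.I) * ((c : ℂ) * p + (d : ℂ)) =
            (a : ℂ) * p + (b : ℂ) ∨
         p * ((c : ℂ) * ((β - (t : ℂ)) / (2 * (Real.pi : ℂ) * Complex.I)) + (d : ℂ)) =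
            (a : ℂ) * ((β - (t : ℂ)) / (2 * (Real.pi : ℂ) * Complex.I)) + (b : ℂ))}) →
    ∀ (m : ℕ) (u : Fin m → ℂ), 1 ≤ m →
      LinearIndependent ℚ
        (Fin.cons (2 * (Real.pi : ℂ) * Complex.I) (Fin.cons (1 : ℂ) u) : Fin (m + 2) → ℂ) →
      ∃ w : Fin (m + 2) → ℂ, LinearIndependent ℚ w ∧
        Submodule.span ℚ (Set.range w) = Submodule.span ℚ (Set.range
          (Fin.cons (2 * (Real.pi : ℂ) * Complex.I) (Fin.cons (1 : ℂ) u) : Fin (m + 2) → ℂ)) ∧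
        (∀ j, (w j).re < 0) ∧
        (∀ j, Transcendental ℚ (w j / (2 * (Real.pi : ℂ) * Complex.I))) ∧
        (∀ i j, i ≠ j → ∀ a b c d : ℚ, 0 < a * d - b * c →
          (w j / (2 * (Real.pi : ℂ) * Complex.I)) *
              ((c : ℂ) * (w i / (2 * (Real.pi : ℂ) * Complex.I)) + (d : ℂ)) ≠
            (a : ℂ) * (w i / (2 * (Real.pi : ℂ) * Complex.I)) + (b : ℂ)) := by
  intro hK0 m u hm hu
  set T : ℂ := 2 * (Real.pi : ℂ) * Complex.I with hT
  have hT0 : T ≠ 0 := by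
    rw [hT]
    exact Complex.two_pi_I_ne_zero
  have hTt : Transcendental ℚ T := by
    rw [hT]
    exact Literature.NumberTheory.Transcendental.transcendental_two_pi_I
  -- the slots
  set j0 : Fin m := ⟨0, by omega⟩ with hj0
  set β : ℕ → ℂ := fun s => if h : s < m then u ⟨s, h⟩ else if s = m then T + u j0 else 2 * T + u j0
    with hβ
  have hβlt : ∀ (s : ℕ) (h : s < m), β s = u ⟨s, h⟩ := by
    intro s h
    simp [hβ, h]
  have hβm : β m = T + u j0 := by
    simp [hβ]
  have hβgt : ∀ s : ℕ, m < s → β s = 2 * T + u j0 := by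
    intro s h
    simp [hβ, not_lt.2 h.le, Nat.ne_of_gt h]
  -- every slot base keeps `(1, T, β s)` independent, so the Key Lemma applies at every slot
  have hβind : ∀ s : ℕ, LinearIndependent ℚ ![(1 : ℂ), T, β s] := by
    intro s
    rcases lt_trichotomy s m with h | rfl | h
    · exact slot_indep hu (β s) 0 ⟨s, h⟩ (by rw [hβlt s h]; push_cast; ring)
    · exact slot_indep hu (β s) 1 j0 (by rw [hβm]; push_cast; ring)
    · exact slot_indep hu (β s) 2 j0 (by rw [hβgt s h]; push_cast; ring)
  have hK : ∀ (s : ℕ) (p : ℂ), Set.Finite {q : ℚ | ∃ a b c d : ℚ, 0 < a * d - b * c ∧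
      ((β s - (q : ℂ)) / T * ((c : ℂ) * p + (d : ℂ)) = (a : ℂ) * p + (b : ℂ) ∨
       p * ((c : ℂ) * ((β s - (q : ℂ)) / T) + (d : ℂ)) =
         (a : ℂ) * ((β s - (q : ℂ)) / T) + (b : ℂ))} :=
    fun s p => hK0 (β s) p (hβind s)
  -- choose the shifts
  obtain ⟨t, hre, htr, hrel, hdet⟩ := slot_all hTt hT0 hK (m + 2)
  have hδ : (t (m + 1) : ℚ) ≠ 2 * t m - t 0 := hdet le_rfl
  -- the basis
  set w : Fin (m + 2) → ℂ := fun i => β i.val - (t i.val : ℂ) with hw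
  -- the ambient span `V` and the span `W` of `w`
  set V : Submodule ℚ ℂ := Submodule.span ℚ (Set.range
    (Fin.cons T (Fin.cons (1 : ℂ) u) : Fin (m + 2) → ℂ)) with hV
  have hTV : T ∈ V := Submodule.subset_span ⟨0, rfl⟩
  have h1V : (1 : ℂ) ∈ V := Submodule.subset_span ⟨Fin.succ 0, by simp⟩
  have huV : ∀ j : Fin m, u j ∈ V := fun j => Submodule.subset_span ⟨j.succ.succ, by simp⟩
  have hβV : ∀ s : ℕ, β s ∈ V := by
    intro s
    rcases lt_trichotomy s m with h | rfl | h
    · rw [hβlt s h]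
      exact huV _
    · rw [hβm]
      exact V.add_mem hTV (huV _)
    · rw [hβgt s h, two_mul]
      exact V.add_mem (V.add_mem hTV hTV) (huV _)
  have hnatV : ∀ n : ℕ, (n : ℂ) ∈ V := by
    intro n
    have := V.smul_mem (n : ℚ) h1V
    rwa [Rat.smul_def, mul_one, Rat.cast_natCast] at this
  have hwV : ∀ i, w i ∈ V := fun i => V.sub_mem (hβV _) (hnatV _)
  set W : Submodule ℚ ℂ := Submodule.span ℚ (Set.range w) with hW
  have hwW : ∀ i, w i ∈ W := fun i => Submodule.subset_span ⟨i, rfl⟩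
  -- three named slots
  have hw0 : w ⟨0, by omega⟩ = u j0 - (t 0 : ℂ) := by
    simp only [hw]
    rw [hβlt 0 (by omega)]
  have hwm : w ⟨m, by omega⟩ = T + u j0 - (t m : ℂ) := by
    simp only [hw]
    rw [hβm]
  have hwm1 : w ⟨m + 1, by omega⟩ = 2 * T + u j0 - (t (m + 1) : ℂ) := by
    simp only [hw]
    rw [hβgt (m + 1) (by omega)]
  -- `1 ∈ W` through `δ = w_{m+1} - 2 w_m + w_0 = 2 t_m - t_0 - t_{m+1} ≠ 0`
  have hδ0 : (2 * (t m : ℚ) - t 0 - t (m + 1)) ≠ 0 := sub_ne_zero.2 hδ.symm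
  have hkey : (((2 * (t m : ℚ) - t 0 - t (m + 1)) : ℚ) : ℂ) =
      w ⟨m + 1, by omega⟩ - 2 * w ⟨m, by omega⟩ + w ⟨0, by omega⟩ := by
    rw [hwm1, hwm, hw0]
    push_cast
    ring
  have hδW : (((2 * (t m : ℚ) - t 0 - t (m + 1)) : ℚ) : ℂ) ∈ W := by
    rw [hkey]
    refine W.add_mem (W.sub_mem (hwW _) ?_) (hwW _)
    rw [two_mul]
    exact W.add_mem (hwW _) (hwW _)
  have h1W : (1 : ℂ) ∈ W := by
    have := W.smul_mem ((2 * (t m : ℚ) - t 0 - t (m + 1))⁻¹ : ℚ) hδW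
    rwa [Rat.smul_def, ← Rat.cast_mul, inv_mul_cancel₀ hδ0, Rat.cast_one] at this
  have hnatW : ∀ n : ℕ, (n : ℂ) ∈ W := by
    intro n
    have := W.smul_mem (n : ℚ) h1W
    rwa [Rat.smul_def, mul_one, Rat.cast_natCast] at this
  have huW : ∀ j : Fin m, u j ∈ W := by
    intro j
    have e : u j = w ⟨j.val, by omega⟩ + (t j.val : ℂ) := by
      simp only [hw]
      rw [hβlt j.val j.isLt]
      simp
    rw [e]
    exact W.add_mem (hwW _) (hnatW _)
  have hTW : T ∈ W := by
    have e : T = w ⟨m, by omega⟩ - u j0 + (t m : ℂ) := by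
      rw [hwm]
      ring
    rw [e]
    exact W.add_mem (W.sub_mem (hwW _) (huW _)) (hnatW _)
  have hspan : W = V := by
    apply le_antisymm
    · rw [hW, Submodule.span_le]
      rintro _ ⟨i, rfl⟩
      exact hwV i
    · rw [hV, Submodule.span_le]
      rintro _ ⟨i, rfl⟩
      refine Fin.cases ?_ (fun i => ?_) i
      · simpa using hTW
      · refine Fin.cases ?_ (fun i => ?_) i
        · simpa using h1W
        · simpa using huW i
  refine ⟨w, ?_, ?_, ?_, ?_, ?_⟩
  · -- independence by the `finrank` count
    rw [linearIndependent_iff_card_eq_finrank_span, Fintype.card_fin]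
    show m + 2 = Module.finrank ℚ (Submodule.span ℚ (Set.range w))
    rw [← hW, hspan, hV, finrank_span_eq_card hu, Fintype.card_fin]
  · rw [← hW, hspan]
  · intro j
    have := hre j.val j.isLt
    show (β j.val - (t j.val : ℂ)).re < 0
    rw [Complex.sub_re, Complex.natCast_re]
    linarith
  · intro j
    exact htr j.val j.isLt
  · intro i j hij a b c d hdet' heq
    rcases lt_or_gt_of_ne (fun h : i.val = j.val => hij (Fin.ext h)) with hlt | hlt
    · exact hrel j.val j.isLt i.val hlt ⟨a, b, c, d, hdet', Or.inl heq⟩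
    · exact hrel i.val i.isLt j.val hlt ⟨a, b, c, d, hdet', Or.inr heq⟩


/-! # Part III — enlargement, period basis, composition -/

/-! ### Sorry-free glue, part 1: the ENLARGEMENT step of the crux (`k ≤ 3`) -/

/-- The range of `Fin.snoc v x` is `range v ∪ {x}`. -/
theorem range_fin_snoc {α : Type*} {n : ℕ} (v : Fin n → α) (x : α) :
    Set.range (Fin.snoc v x : Fin (n + 1) → α) = Set.range v ∪ {x} := by
  ext a
  constructor
  · rintro ⟨i, rfl⟩
    refine Fin.lastCases ?_ (fun j => ?_) i
    · right
      simp [Fin.snoc_last]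
    · left
      exact ⟨j, by simp [Fin.snoc_castSucc]⟩
  · rintro (⟨j, rfl⟩ | h)
    · exact ⟨Fin.castSucc j, by simp [Fin.snoc_castSucc]⟩
    · rw [Set.mem_singleton_iff] at h
      subst h
      exact ⟨Fin.last n, by simp [Fin.snoc_last]⟩

/-- One enlargement step: adjoin `x` (algebraic, or with algebraic exponential) to the running
independent family `v` (with `range v = range z ∪ range e`, `e` the numbers adjoined so far) if
and only if it is missing from the span. -/
theorem enlarge_step (n : ℕ) (z : Fin n → ℂ) (x : ℂ)
    (hx : IsAlgebraic ℚ x ∨ IsAlgebraic ℚ (Complex.exp x))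
    (k N : ℕ) (e : Fin k → ℂ) (v : Fin N → ℂ) (hN : N = n + k)
    (he : ∀ i, IsAlgebraic ℚ (e i) ∨ IsAlgebraic ℚ (Complex.exp (e i)))
    (hv : LinearIndependent ℚ v) (hr : Set.range v = Set.range z ∪ Set.range e) :
    ∃ (k' N' : ℕ) (e' : Fin k' → ℂ) (v' : Fin N' → ℂ), N' = n + k' ∧
      (∀ i, IsAlgebraic ℚ (e' i) ∨ IsAlgebraic ℚ (Complex.exp (e' i))) ∧
      LinearIndependent ℚ v' ∧ Set.range v' = Set.range z ∪ Set.range e' ∧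
      x ∈ Submodule.span ℚ (Set.range v') ∧ Set.range v ⊆ Set.range v' := by
  by_cases hmem : x ∈ Submodule.span ℚ (Set.range v)
  · exact ⟨k, N, e, v, hN, he, hv, hr, hmem, subset_rfl⟩
  · refine ⟨k + 1, N + 1, Fin.snoc e x, Fin.snoc v x, by omega, ?_, ?_, ?_, ?_, ?_⟩
    · intro i
      refine Fin.lastCases ?_ (fun j => ?_) i
      · simpa [Fin.snoc_last] using hx
      · simpa [Fin.snoc_castSucc] using he j
    · exact linearIndependent_finSnoc.2 ⟨hv, hmem⟩
    · rw [range_fin_snoc, range_fin_snoc, hr, Set.union_assoc]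
    · apply Submodule.subset_span
      rw [range_fin_snoc]
      exact Or.inr rfl
    · rw [range_fin_snoc]
      exact Set.subset_union_left

/-- `√2` is algebraic over `ℚ` (as a complex number). -/
theorem isAlgebraic_sqrt_two : IsAlgebraic ℚ ((Real.sqrt 2 : ℝ) : ℂ) := by
  refine ⟨Polynomial.X ^ 2 - Polynomial.C 2, Polynomial.Monic.ne_zero (by monicity!), ?_⟩
  have h2 : ((Real.sqrt 2 : ℝ) : ℂ) ^ 2 = 2 := by
    rw [← Complex.ofReal_pow, Real.sq_sqrt (by norm_num : (0 : ℝ) ≤ 2)]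
    push_cast
    rfl
  simp only [map_sub, map_pow, Polynomial.aeval_X, Polynomial.aeval_C, eq_ratCast, h2]
  push_cast
  ring

/-- `exp (2πi) = 1` is algebraic. -/
theorem isAlgebraic_exp_two_pi_I :
    IsAlgebraic ℚ (Complex.exp (2 * (Real.pi : ℂ) * Complex.I)) := by
  rw [Complex.exp_two_pi_mul_I]
  exact isAlgebraic_one

/-- `1, 2πi, √2` are `ℚ`-linearly independent (`2πi ∉ ℝ`, `√2 ∉ ℚ`). -/
theorem linearIndependent_one_twoPiI_sqrt_two :
    LinearIndependent ℚ ![(1 : ℂ), 2 * (Real.pi : ℂ) * Complex.I, ((Real.sqrt 2 : ℝ) : ℂ)] := by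
  rw [Fintype.linearIndependent_iff]
  intro g hg
  rw [Fin.sum_univ_three] at hg
  simp only [Matrix.cons_val_zero, Matrix.cons_val_one, Matrix.head_cons,
    Matrix.cons_val_two, Matrix.tail_cons] at hg
  have him : ((g 1 : ℚ) : ℝ) * (2 * Real.pi) = 0 := by
    have h := congrArg Complex.im hg
    simp only [Complex.add_im, Rat.smul_def, Complex.mul_im, Complex.mul_re, Complex.ratCast_re,
      Complex.ratCast_im, Complex.one_im, Complex.one_re, Complex.ofReal_im, Complex.ofReal_re,
      Complex.I_im, Complex.I_re, Complex.re_ofNat, Complex.im_ofNat, Complex.zero_im] at h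
    linear_combination h
  have hre : ((g 0 : ℚ) : ℝ) + ((g 2 : ℚ) : ℝ) * Real.sqrt 2 = 0 := by
    have h := congrArg Complex.re hg
    simp only [Complex.add_re, Rat.smul_def, Complex.mul_im, Complex.mul_re, Complex.ratCast_re,
      Complex.ratCast_im, Complex.one_im, Complex.one_re, Complex.ofReal_im, Complex.ofReal_re,
      Complex.I_im, Complex.I_re, Complex.re_ofNat, Complex.im_ofNat, Complex.zero_re] at h
    linear_combination h
  have h1 : g 1 = 0 := by
    have : ((g 1 : ℚ) : ℝ) = 0 := (mul_eq_zero.1 him).resolve_right (by positivity)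
    exact_mod_cast this
  have h2 : g 2 = 0 := by
    by_contra hne
    have hirr : Irrational (((g 0 : ℚ) : ℝ) + ((g 2 : ℚ) : ℝ) * Real.sqrt 2) :=
      (irrational_sqrt_two.ratCast_mul hne).ratCast_add (g 0)
    exact hirr ⟨0, by push_cast; linarith [hre]⟩
  have h0 : g 0 = 0 := by
    have : ((g 0 : ℚ) : ℝ) = 0 := by
      rw [h2] at hre
      push_cast at hre
      linarith [hre]
    exact_mod_cast this
  intro i
  fin_cases i
  · exact h0
  · exact h1
  · exact h2

/-- **`Enlarge`** (PROVED; the crux's enlargement step).  Every `ℚ`-linearly independent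
`z : Fin n → ℂ` extends by `k ≤ 3` numbers `eᵢ`, each algebraic or with algebraic exponential
(`2πi` if missing, then `1`, then `√2`), to an independent family `v : Fin N → ℂ`, `N = n + k`,
`range v = range z ∪ range e`, whose span contains `1` and `2πi` and has dimension `N ≥ 3`
(dimension count: `1, 2πi, √2` lie in the span and are independent). -/
theorem enlarge (n : ℕ) (z : Fin n → ℂ) (hz : LinearIndependent ℚ z) :
    ∃ (k N : ℕ) (e : Fin k → ℂ) (v : Fin N → ℂ), N = n + k ∧
      (∀ i, IsAlgebraic ℚ (e i) ∨ IsAlgebraic ℚ (Complex.exp (e i))) ∧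
      LinearIndependent ℚ v ∧ Set.range v = Set.range z ∪ Set.range e ∧
      (1 : ℂ) ∈ Submodule.span ℚ (Set.range v) ∧
      (2 * (Real.pi : ℂ) * Complex.I) ∈ Submodule.span ℚ (Set.range v) ∧ 3 ≤ N := by
  have h0 : Set.range z = Set.range z ∪ Set.range (Fin.elim0 : Fin 0 → ℂ) := by
    rw [Set.range_eq_empty Fin.elim0, Set.union_empty]
  obtain ⟨k₁, N₁, e₁, v₁, hN₁, he₁, hv₁, hr₁, hx₁, -⟩ :=
    enlarge_step n z (2 * (Real.pi : ℂ) * Complex.I) (Or.inr isAlgebraic_exp_two_pi_I) 0 n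
      Fin.elim0 z (by omega) (fun i => Fin.elim0 i) hz h0
  obtain ⟨k₂, N₂, e₂, v₂, hN₂, he₂, hv₂, hr₂, hx₂, hsub₂⟩ :=
    enlarge_step n z (1 : ℂ) (Or.inl isAlgebraic_one) k₁ N₁ e₁ v₁ hN₁ he₁ hv₁ hr₁
  obtain ⟨k₃, N₃, e₃, v₃, hN₃, he₃, hv₃, hr₃, hx₃, hsub₃⟩ :=
    enlarge_step n z ((Real.sqrt 2 : ℝ) : ℂ) (Or.inl isAlgebraic_sqrt_two) k₂ N₂ e₂ v₂ hN₂ he₂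
      hv₂ hr₂
  have h1 : (1 : ℂ) ∈ Submodule.span ℚ (Set.range v₃) := Submodule.span_mono hsub₃ hx₂
  have h2 : (2 * (Real.pi : ℂ) * Complex.I) ∈ Submodule.span ℚ (Set.range v₃) :=
    Submodule.span_mono (hsub₂.trans hsub₃) hx₁
  refine ⟨k₃, N₃, e₃, v₃, hN₃, he₃, hv₃, hr₃, h1, h2, ?_⟩
  -- dimension count inside `W = span (range v₃)`: `1, 2πi, √2 ∈ W` are independent
  set W : Submodule ℚ ℂ := Submodule.span ℚ (Set.range v₃) with hW
  haveI : FiniteDimensional ℚ W := FiniteDimensional.span_of_finite ℚ (Set.finite_range v₃)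
  have hfin : Module.finrank ℚ W = N₃ := by
    rw [hW, finrank_span_eq_card hv₃, Fintype.card_fin]
  let g : Fin 3 → W :=
    ![⟨(1 : ℂ), h1⟩, ⟨2 * (Real.pi : ℂ) * Complex.I, h2⟩, ⟨((Real.sqrt 2 : ℝ) : ℂ), hx₃⟩]
  have hg : W.subtype ∘ g =
      ![(1 : ℂ), 2 * (Real.pi : ℂ) * Complex.I, ((Real.sqrt 2 : ℝ) : ℂ)] := by
    funext i
    fin_cases i <;> rfl
  have hlig : LinearIndependent ℚ g := by
    apply LinearIndependent.of_comp W.subtype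
    rw [hg]
    exact linearIndependent_one_twoPiI_sqrt_two
  have := hlig.fintype_card_le_finrank
  rw [Fintype.card_fin, hfin] at this
  exact this

/-! ### Sorry-free glue, part 2: RE-BASING THROUGH THE PERIODS `(2πi, 1, u₁, …, u_m)` -/

/-- `2πi` is not a rational multiple of `1`: the pair `(2πi, 1)` heads a `ℚ`-independent family. -/
theorem linearIndependent_twoPiI_one :
    LinearIndependent ℚ
      (Fin.cons (2 * (Real.pi : ℂ) * Complex.I) (Fin.cons (1 : ℂ) (Fin.elim0 : Fin 0 → ℂ)) :
        Fin 2 → ℂ) := by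
  rw [linearIndependent_finCons, linearIndependent_finCons]
  refine ⟨⟨linearIndependent_empty_type, ?_⟩, ?_⟩
  · have : Set.range (Fin.elim0 : Fin 0 → ℂ) = ∅ := Set.range_eq_empty _
    rw [this, Submodule.span_empty]
    simp
  · intro hmem
    have hr : Set.range (Fin.cons (1 : ℂ) (Fin.elim0 : Fin 0 → ℂ) : Fin 1 → ℂ) = {(1 : ℂ)} := by
      rw [Fin.range_cons, Set.range_eq_empty, Set.insert_eq, Set.union_empty]
    rw [hr, Submodule.mem_span_singleton] at hmem
    obtain ⟨q, hq⟩ := hmem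
    have him := congrArg Complex.im hq
    simp at him

/-- Inductive extension inside `W`: a `ℚ`-independent family `(2πi, 1, u)` with values in a
finite-dimensional subspace `W ∋ 1, 2πi` of dimension `≥ j + 2` exists for every such `j`. -/
theorem periodBasis_aux (W : Submodule ℚ ℂ) [FiniteDimensional ℚ W]
    (h1 : (1 : ℂ) ∈ W) (h2 : (2 * (Real.pi : ℂ) * Complex.I) ∈ W) :
    ∀ j : ℕ, j + 2 ≤ Module.finrank ℚ W →
      ∃ u : Fin j → ℂ, (∀ i, u i ∈ W) ∧
        LinearIndependent ℚ
          (Fin.cons (2 * (Real.pi : ℂ) * Complex.I) (Fin.cons (1 : ℂ) u) : Fin (j + 2) → ℂ) := by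
  intro j
  induction j with
  | zero =>
    intro _
    exact ⟨Fin.elim0, fun i => Fin.elim0 i, linearIndependent_twoPiI_one⟩
  | succ j ih =>
    intro hj
    obtain ⟨u, huW, hli⟩ := ih (by omega)
    -- lift the family to `W`
    set f : Fin (j + 2) → ℂ :=
      (Fin.cons (2 * (Real.pi : ℂ) * Complex.I) (Fin.cons (1 : ℂ) u) : Fin (j + 2) → ℂ) with hf
    have hfW : ∀ i, f i ∈ W := by
      intro i
      refine Fin.cases ?_ (fun i => ?_) i
      · simpa [hf] using h2
      · refine Fin.cases ?_ (fun i => ?_) i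
        · simpa [hf] using h1
        · simpa [hf] using huW i
    let f' : Fin (j + 2) → W := fun i => ⟨f i, hfW i⟩
    have hf'f : W.subtype ∘ f' = f := by
      funext i
      rfl
    have hli' : LinearIndependent ℚ f' := by
      apply LinearIndependent.of_comp W.subtype
      rw [hf'f]
      exact hli
    obtain ⟨b, hb⟩ := exists_linearIndependent_snoc_of_lt_finrank hli' (by omega)
    have hbC : LinearIndependent ℚ (W.subtype ∘ Fin.snoc f' b) :=
      hb.map' W.subtype (Submodule.ker_subtype W)
    have hsnoc : (W.subtype ∘ Fin.snoc f' b : Fin (j + 2 + 1) → ℂ) = Fin.snoc f (b : ℂ) := by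
      funext i
      refine Fin.lastCases ?_ (fun i => ?_) i
      · simp [Fin.snoc_last]
      · simp only [Function.comp_apply, Fin.snoc_castSucc]
        rfl
    rw [hsnoc] at hbC
    refine ⟨Fin.snoc u (b : ℂ), ?_, ?_⟩
    · intro i
      refine Fin.lastCases ?_ (fun i => ?_) i
      · simp [Fin.snoc_last]
      · simpa [Fin.snoc_castSucc] using huW i
    · have e : (Fin.cons (2 * (Real.pi : ℂ) * Complex.I) (Fin.cons (1 : ℂ) (Fin.snoc u (b : ℂ))) :
          Fin (j + 1 + 2) → ℂ) = Fin.snoc f (b : ℂ) := by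
        rw [hf, ← Fin.cons_snoc_eq_snoc_cons, ← Fin.cons_snoc_eq_snoc_cons]
      rw [e]
      exact hbC

/-- **`PeriodBasis`** (PROVED).  If `v : Fin N → ℂ` is `ℚ`-linearly independent and its span
contains `1` and `2πi`, the span has a `ℚ`-basis `(2πi, 1, u₁, …, u_m)` with `N = m + 2`. -/
theorem periodBasis_exists (N : ℕ) (v : Fin N → ℂ) (hv : LinearIndependent ℚ v)
    (h1 : (1 : ℂ) ∈ Submodule.span ℚ (Set.range v))
    (h2 : (2 * (Real.pi : ℂ) * Complex.I) ∈ Submodule.span ℚ (Set.range v)) :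
    ∃ (m : ℕ) (u : Fin m → ℂ), N = m + 2 ∧
      LinearIndependent ℚ
        (Fin.cons (2 * (Real.pi : ℂ) * Complex.I) (Fin.cons (1 : ℂ) u) : Fin (m + 2) → ℂ) ∧
      Submodule.span ℚ (Set.range
        (Fin.cons (2 * (Real.pi : ℂ) * Complex.I) (Fin.cons (1 : ℂ) u) : Fin (m + 2) → ℂ)) =
        Submodule.span ℚ (Set.range v) := by
  set W : Submodule ℚ ℂ := Submodule.span ℚ (Set.range v) with hW
  haveI : FiniteDimensional ℚ W := FiniteDimensional.span_of_finite ℚ (Set.finite_range v)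
  have hfin : Module.finrank ℚ W = N := by
    rw [hW, finrank_span_eq_card hv, Fintype.card_fin]
  -- `N ≥ 2`: the independent pair `(2πi, 1)` lives in `W`
  have hN2 : 2 ≤ N := by
    let g : Fin 2 → W := Fin.cons ⟨2 * (Real.pi : ℂ) * Complex.I, h2⟩
      (Fin.cons ⟨(1 : ℂ), h1⟩ (Fin.elim0 : Fin 0 → W))
    have hg : W.subtype ∘ g =
        (Fin.cons (2 * (Real.pi : ℂ) * Complex.I) (Fin.cons (1 : ℂ) (Fin.elim0 : Fin 0 → ℂ)) :
          Fin 2 → ℂ) := by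
      funext i
      refine Fin.cases ?_ (fun i => ?_) i
      · rfl
      · refine Fin.cases ?_ (fun i => ?_) i
        · rfl
        · exact Fin.elim0 i
    have hlig : LinearIndependent ℚ g := by
      apply LinearIndependent.of_comp W.subtype
      rw [hg]
      exact linearIndependent_twoPiI_one
    have := hlig.fintype_card_le_finrank
    rw [Fintype.card_fin, hfin] at this
    exact this
  obtain ⟨u, huW, hli⟩ := periodBasis_aux W h1 h2 (N - 2) (by omega)
  refine ⟨N - 2, u, by omega, hli, ?_⟩
  -- the independent family of full cardinality inside `W` spans `W`
  apply Submodule.eq_of_le_of_finrank_eq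
  · rw [Submodule.span_le]
    rintro x ⟨i, rfl⟩
    refine Fin.cases ?_ (fun i => ?_) i
    · simpa using h2
    · refine Fin.cases ?_ (fun i => ?_) i
      · simpa using h1
      · simpa using huW i
  · rw [finrank_span_eq_card hli, hfin, Fintype.card_fin]
    omega

/-! ### Sorry-free glue, part 3: reindexing and the non-quadratic clause -/

/-- A transcendental number is not a root of a rational quadratic (the crux's non-quadratic
clause follows from the stronger transcendence delivered by `stub_shiftedTateBasis`). -/
theorem not_quadratic_of_transcendental {τ : ℂ} (hτ : Transcendental ℚ τ) (b c : ℚ) :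
    τ ^ 2 + (b : ℂ) * τ + (c : ℂ) ≠ 0 := by
  intro h
  apply hτ
  refine ⟨Polynomial.X ^ 2 + Polynomial.C b * Polynomial.X + Polynomial.C c, ?_, ?_⟩
  · exact Polynomial.Monic.ne_zero (by monicity!)
  · simp only [map_add, map_mul, map_pow, Polynomial.aeval_X, Polynomial.aeval_C, eq_ratCast]
    exact h

/-- Transport of a shifted Tate basis along `Fin (m + 2) = Fin N` (pure reindexing). -/
theorem tateBasis_transport {N m : ℕ} (h : N = m + 2) {S : Submodule ℚ ℂ} {w : Fin (m + 2) → ℂ}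
    (hw : LinearIndependent ℚ w) (hspan : Submodule.span ℚ (Set.range w) = S)
    (hre : ∀ j, (w j).re < 0)
    (htr : ∀ j, Transcendental ℚ (w j / (2 * (Real.pi : ℂ) * Complex.I)))
    (hmob : ∀ i j, i ≠ j → ∀ a b c d : ℚ, 0 < a * d - b * c →
      (w j / (2 * (Real.pi : ℂ) * Complex.I)) *
          ((c : ℂ) * (w i / (2 * (Real.pi : ℂ) * Complex.I)) + (d : ℂ)) ≠
        (a : ℂ) * (w i / (2 * (Real.pi : ℂ) * Complex.I)) + (b : ℂ)) :
    ∃ w' : Fin N → ℂ, LinearIndependent ℚ w' ∧ Submodule.span ℚ (Set.range w') = S ∧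
      (∀ j, (w' j).re < 0) ∧
      (∀ j, Transcendental ℚ (w' j / (2 * (Real.pi : ℂ) * Complex.I))) ∧
      (∀ i j, i ≠ j → ∀ a b c d : ℚ, 0 < a * d - b * c →
        (w' j / (2 * (Real.pi : ℂ) * Complex.I)) *
            ((c : ℂ) * (w' i / (2 * (Real.pi : ℂ) * Complex.I)) + (d : ℂ)) ≠
          (a : ℂ) * (w' i / (2 * (Real.pi : ℂ) * Complex.I)) + (b : ℂ)) := by
  subst h
  exact ⟨w, hw, hspan, hre, htr, hmob⟩

/-! ## The crux (concluded BY NAME) -/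

/-- **`TateNomes.NomeHygiene`** (crux #3 of route `TateNomes`, item stmt-Schanuel-17298): enlarge
(`enlarge`), re-base through the periods (`periodBasis_exists`), shift by natural numbers
(`stub_shiftedTateBasis`, fed the Key Lemma `stub_shiftCoincidence`), transport the index type
along `n + k = m + 2`, and read off the seven conjuncts. -/
theorem nomeHygiene_holds : Summit.Schanuel.Schanuel.Theses.TateNomes.NomeHygiene := by
  intro n z hz
  obtain ⟨k, N, e, v, hN, he, hv, hr, h1, h2pi, h3⟩ := enlarge n z hz
  obtain ⟨m, u, hNm, hu, hspanu⟩ := periodBasis_exists N v hv h1 h2pi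
  have hm : 1 ≤ m := by omega
  obtain ⟨w₀, hw₀, hspan₀, hre₀, htr₀, hmob₀⟩ :=
    stub_shiftedTateBasis stub_shiftCoincidence m u hm hu
  obtain ⟨w, hw, hspan, hre, htr, hmob⟩ :=
    tateBasis_transport (N := n + k) (by omega) hw₀ (hspan₀.trans hspanu) hre₀ htr₀ hmob₀
  refine ⟨k, e, w, he, hw, ?_, ?_, hre, ?_, hmob⟩
  · rw [hspan, hr]
  · rw [hspan]
    exact h2pi
  · intro j b c
    exact not_quadratic_of_transcendental (htr j) b c

end Summit.Schanuel.Schanuel.Theorems.TateNomesNomeHygiene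

end
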